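import Literature.MathematicalPhysics.QuantumFieldTheory.Balaban1983to89.B11Eq117LetterDefectsTowerTwoBackgrounds
import Literature.MathematicalPhysics.QuantumFieldTheory.Balaban1983to89.B11Eq120SolutionContinuity
import Literature.MathematicalPhysics.QuantumFieldTheory.Balaban1983to89.B11Eq44CLetterTower

/-!
# `Balaban1983to89.B11Eq174ChartContinuityTowerTwoBackgrounds` — T. Bałaban, *The variational problem and background fields in renormalization group
# method for lattice gauge theories*, Commun. Math. Phys. **102** (1985) 277–309 [Balaban1985Variational] Prop. 6 (116)–(121) p. 295, (174)–(175) p. 305,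
# Prop. 9 p. 309, with [Balaban1985BackgroundPropagators] Thm 3.4 p. 400: THE CONFIGURATION OF THE CHART (174) AT THE `k`-TH-STEP LETTERS IS LIPSCHITZ IN
# THE BACKGROUND BETWEEN TWO SMALL BACKGROUNDS `U`, `V` ON PRINT's DIAGONAL — `‖ι(𝒜_U(H_k(U)B) + H_k(U)B) − (𝒜_V(H_k(V)B) + H_k(V)B)‖_(115),∇_V ≤
# (K·V_G·δ·(j + C₄(ε₄ + a)²) + B₀′δ_W + K·V_H·δ·‖B‖)∕(1 − κ₂)` with `K` LEVEL-FREE, (117)'s products `V_G`, `V_H` and the (L3) slot's modulus `δ_W`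
# DISPLAYED; and the same for the full chart (174)∘(47) with the Sect. C slot `C_k`, modulo `δ_W`, `δ_C` — the `k`-level twin of this lineage's one-step
# `B11Eq174ChartContinuityTwoBackgrounds` (gen 73), one storey above `B11Eq117LetterDefectsTowerTwoBackgrounds` (gen 78 INTENT-2)

statement-level skeleton of published theorems with citation tags; proofs where landed; nothing here is a claim about the Yang–Mills mass gap

PDF held: `paper:balaban1985-cmp102-variational-background` (journal page = PDF page + 276) p. 295 Prop. 6, p. 305 (174)–(175), p. 309 Prop. 9;
`paper:balaban1985-cmp99-background-propagators` (journal page = PDF page + 388) p. 400 Thm 3.4 — through the verbatim quotations of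
`B11Eq174ChartContinuityAtFlat` (NE9 owner gen 82), whose two theorems this file runs at `k = n+1` levels between two backgrounds.  Print proves
analyticity in `𝔄`∕`B` at a fixed background and analyticity of the LETTERS in the background; the Lipschitz continuity of the chart's configuration
between two backgrounds is the cell's composition of the two.  SEQUEL (v1.1, gen 79; doc-only): the π twin of this file (print's operator (3.122) in the slot) is the
last storey of the (T4) ladder started by `B9Eq353FormDefectTowerPiTwoBackgrounds` ∕ `B9Eq386GreenkLipschitzEnergyPiTwoBackgrounds` (gen 79).

CITATION HEADER (lean-in-tree rule 2026-08-18).  Audit cell `pub-balaban`, sub-cell `t4`, NE9 crux team (2): LEAF PROVER 04 (`b2b-balaban-t4-ne9-formalise-leaf-04`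
gen 78), INTENT-3 — the top Literature junction of the two-background («(b3)») ladder at the chain's letters: inputs INTENT-2
`B11Eq117LetterDefectsTowerTwoBackgrounds.exists_letter_defects_tower_two_backgrounds_closed` (the defects `K_ι`, `δ_G`, `δ_A` with the `L²` letters
level-free) and the owner's ABSTRACT two-carrier comparison `B11Eq120SolutionContinuity.norm_map_arg_sub_arg_le` ∕ `norm_map_chartHB_sectC_sub_le` BY
NAME; the Sect. C letter at `k` levels is `B11Eq44CLetterTower.Cck`.  WHY: NE9 compares the `k`-th-step chart of `cur U` for two coupling histories —
two small backgrounds `U`, `V`; this is the Literature side of that comparison ((B″)₂-k), the Support statement ((Z)₂-k) being FROZEN (ruling (0)).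

WHAT IS PROVED (sorry-free; composition; 0 def; no inequality of the paper asserted).
* **`exists_chart_arg_lipschitz_tower_two_backgrounds`** — `∃ α₀ δ₀ K > 0` (`K` closed in `(d, a, L, M_φ, M_φ′, r, C_τ, ρ_w)`) such that under the binders of
  INTENT-2 (`3 ≤ L^{n+1}`, `ηL^{n+1} = 1`, diagonal weights, E162's data ×2, unitarity ×2, `U1` ×2, bond ∕ plaquette windows ×2, the closeness windows
  `δη` ∕ `δη²`, the level and closeness profiles, ANY level maps, ANY witnesses), for ALL (L3) slots `W_U`, `W_V`, regimes `R_U`, `R_V`, block fields `B`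
  with `‖H_k(U)B‖ < a`, `‖H_k(V)B‖ < a′`, a modulus `‖W_U P − W_V(ιP)‖ ≤ δ_W` on `‖P‖ < ε₄ + a`, radii `K_ι(ε₄ + a) ≤ ρ`, `ε₄′ + a′ ≤ ρ`, `s > 0`,
  `2(ρ + s) ≤ a₃′`, `κ₂ < 1`, with `K_ι = 1 + w̄₁·(2‖η⁻¹‖·δη)·w̲₀⁻¹`:
  `‖ι(𝒜_U(H_k(U)B) + H_k(U)B) − (𝒜_V(H_k(V)B) + H_k(V)B)‖_(115),∇_V ≤ (K·V_G·δ·(j + C₄(ε₄ + a)²) + B₀′δ_W + K·V_H·δ·‖B‖)∕(1 − κ₂)`.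
* **`exists_chartHB_lipschitz_tower_two_backgrounds`** — the FULL chart (174)∘(47) with the Sect. C T-slot `C_k` (`Cck`): `‖ι(chartHB_U B) − chartHB_V B‖ ≤
  (…)∕((1 − κ₂)(1 − κ_C)) + (K·V_H·δ·C₂(ε_C + a_C)² + b′δ_C)∕(1 − κ_C)`, the `C_k`-letter's modulus `δ_C` and the Sect. C regimes DISPLAYED.
MODEL ∕ HONEST SCOPE.  As INTENT-2 and `B11Eq174ChartContinuityAtFlat`: (117)'s products `V_G`, `V_H` are load-bearing finite-lattice numbers (the level
maps' extreme weights, `#bonds`, `c₀`, `c₁`, `M_φ`, `M_φ′`) — NOT print's lattice-uniform `B₀`; the `L²` letters behind `K` ARE level-free; both backgrounds in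
the small-field windows (print's running axioms (3.35)); the moduli `δ_W` of the (L3) slot and `δ_C` of the Sect. C letter DISPLAYED, not produced; the
regimes are HYPOTHESES; FIRST order (no analyticity in `U`); the chain's `laplaceAk` (print's `G₀`-slot, D-ne9p1-g87-1) — NOT the Δ_π letters; the
two-background chart comparison of the species `cur U` ∕ `cur V` at `k` levels ((Z)₂-k, a `T4Continuum/Support` statement) is NOT here — FREEZE (0) — its
Literature ingredients are.  NOT summit progress (cell pub-balaban: NE9 NOT PRINTED ∕ NOT PROVED; «NE9 ⇐ the named binders»; row WALLED ON A MODEL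
(O-NE9-1; #5 UNRULED); spine PROVED 0∕9; rung (B)+1 finite T⁴ — NOT infinite volume, NOT mass gap, NOT BetaPertH, NOT Clay).  HONEST DEPENDENCY (cell line):
continuum YM on T⁴ ⇐ BetaPertH ∧ nine spine estimates (0/9 proved); BetaPertH ⇐ (D1) ∧ (D4) ∧ CAP+tail; G-an2-4 gates asym, D1 and NE2/3/4.  NEW file;
nothing modified.  Net new unproved facts: 0.
-/

noncomputable section

namespace Literature.MathematicalPhysics.QuantumFieldTheory.Balaban1983to89.B11Eq174ChartContinuityTowerTwoBackgrounds

open scoped InnerProductSpace ComplexConjugate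
open B11Eq115Space B11Eq111FrakG B11Eq103H1Complex
open B11Eq174Chart (Regime solA chartHB)
open B9SectCLatticeCarrier (Bond)
open B4Sect5Torus (TSite)
open B7Prop1Explicit (U1 Wcx boxVec)
open B9Eq310HessianOperator (adTransportW)
open B9Eq310DeltaPrime (plaqHolU)
open B9Eq315QTorus (perCfg cornerSite)
open B9Eq315QTower (towerP UlevOf)
open B9Eq326OperatorTower (laplaceAk QkW)
open B11Eq117LetterDefectsTowerTwoBackgrounds (exists_letter_defects_tower_two_backgrounds_closed)
open B11Eq120SolutionContinuity (norm_map_arg_sub_arg_le norm_map_chartHB_sectC_sub_le)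
open B11Eq44CLetterTower (Cck)

variable {d : ℕ} (hd : 1 ≤ d) (L : ℕ) [NeZero L] (hL : 1 ≤ L)
  {𝔸 : Type*} [NormedRing 𝔸] [NormedAlgebra ℂ 𝔸] [CompleteSpace 𝔸] [NormOneClass 𝔸] [StarRing 𝔸] [NormedStarGroup 𝔸] [StarModule ℂ 𝔸]
  [FiniteDimensional ℂ 𝔸]
  {W : Type*} [NormedAddCommGroup W] [InnerProductSpace ℂ W] [FiniteDimensional ℂ W] (φ : W ≃ₗ[ℂ] 𝔸)
  {Mφ Mφ' : ℝ} (hMφ : 0 ≤ Mφ) (hMφ' : 0 ≤ Mφ') (hφ : ∀ w, ‖φ w‖ ≤ Mφ * ‖w‖) (hφ' : ∀ X, ‖φ.symm X‖ ≤ Mφ' * ‖X‖)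
  {a₀ : ℝ} (ha₀ : 0 < a₀) {r : ℝ} (hr0 : 0 ≤ r) (hr1 : r < 1)
  (τ : 𝔸 →ₗ[ℂ] ℂ) {Cτ : ℝ} (hτ : ∀ X, ‖τ X‖ ≤ Cτ * ‖X‖) (hCτ : 0 ≤ Cτ) {ρw : ℝ} (hρw : 0 ≤ ρw)
  (hτ₁ : ∀ X : 𝔸, τ (star X) = conj (τ X)) (hτ₂ : ∀ X Y : 𝔸, τ (X * Y) = τ (Y * X))
  (hφτ : ∀ X Y : 𝔸, ⟪φ.symm X, φ.symm Y⟫_ℂ = τ (star X * Y))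

include hd hMφ hMφ' hφ hφ' ha₀ hr0 hr1 hτ hCτ hρw hτ₁ hτ₂ hφτ

set_option maxHeartbeats 800000 in
set_option maxRecDepth 8192 in
/-- **THE CONFIGURATION OF THE CHART (174) AT THE `k`-TH-STEP LETTERS IS LIPSCHITZ IN THE BACKGROUND BETWEEN TWO SMALL BACKGROUNDS (diagonal,
`Λ := 0`, `J := 0` face)** — `∃ α₀ δ₀ K > 0` (`K` level-free) before every binder; then under INTENT-2's binders, for all (L3) slots, regimes, block
fields and moduli as displayed: `‖ι(𝒜_U(H_k(U)B) + H_k(U)B) − (𝒜_V(H_k(V)B) + H_k(V)B)‖_(115),∇_V ≤ (K·V_G·δ·(j + C₄(ε₄ + a)²) + B₀′δ_W + K·V_H·δ·‖B‖)∕(1 − κ₂)`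
— the defects `K_ι`, `δ_G = K·V_G·δ`, `δ_A = K·V_H·δ·‖B‖` PRODUCED by INTENT-2, composed by the owner's `norm_map_arg_sub_arg_le`; this lineage's one-step
`exists_chart_arg_lipschitz_twoBackgrounds` one storey up. [folklore]
[cite: Balaban1985Variational, Prop. 6 (116)–(121) p.295, (117) p.295, (174)–(175) p.305, Prop. 9 p.309; Balaban1985BackgroundPropagators, Thm 3.4 p.400, (3.86) p.407] -/
theorem exists_chart_arg_lipschitz_tower_two_backgrounds [Fact (0 < (L : ℝ))] :
    ∃ α₀ δ₀ K : ℝ, 0 < α₀ ∧ 0 < δ₀ ∧ 0 < K ∧ ∀ (n : ℕ) (η : ℝ) [Fact (0 < η)], η * (L : ℝ) ^ (n + 1) = 1 → 3 ≤ L ^ (n + 1) →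
      ∀ (c₀ c₁ : ℝ) [Fact (0 < c₀)] [Fact (0 < c₁)], c₀ * ((L : ℝ) ^ (n + 1)) ^ d = c₁ → |η| ^ d / c₀ ≤ ρw →
      ∀ (m : Fin d → ℕ) [∀ i, NeZero (m i)] (lev₀ : Bond d (towerP L m (n + 1)) → ℕ) (levB : Bond d m → ℕ)
        (lev₁ : Bond d (towerP L m (n + 1)) × Fin d → ℕ)
        (U V : Bond d (towerP L m (n + 1)) → 𝔸ˣ) (αU : ℕ → ℝ) (hα1 : ∀ j, αU j ≤ 1 / 64)
        (hU1 : ∀ (j : ℕ) (x : B7Prop1Explicit.Site d) (κ : Fin d), perCfg (towerP L m (j + 1)) (UlevOf L m (n + 1) U j) x κ ∈ U1 𝔸)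
        (hreg : ∀ (j : ℕ) (y : TSite d (towerP L m j)) (κ : Fin d) (r : Fin d → Fin L),
          ‖((Wcx L (perCfg (towerP L m (j + 1)) (UlevOf L m (n + 1) U j)) (cornerSite L y) κ (boxVec L r) : 𝔸ˣ) : 𝔸) - 1‖ ≤ αU j)
        (αV : ℕ → ℝ) (hα1' : ∀ j, αV j ≤ 1 / 64)
        (hV1 : ∀ (j : ℕ) (x : B7Prop1Explicit.Site d) (κ : Fin d), perCfg (towerP L m (j + 1)) (UlevOf L m (n + 1) V j) x κ ∈ U1 𝔸)
        (hregV : ∀ (j : ℕ) (y : TSite d (towerP L m j)) (κ : Fin d) (r : Fin d → Fin L),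
          ‖((Wcx L (perCfg (towerP L m (j + 1)) (UlevOf L m (n + 1) V j)) (cornerSite L y) κ (boxVec L r) : 𝔸ˣ) : 𝔸) - 1‖ ≤ αV j),
        (∀ j, αV j ≤ 1 / 128) →
      ∀ (εU : ℕ → ℝ), (∀ j, 0 ≤ εU j) → (∀ (j : ℕ) (b : Bond d (towerP L m (j + 1))), ‖(UlevOf L m (n + 1) U j b : 𝔸) - 1‖ ≤ εU j) →
        (∀ (j : ℕ) (b : Bond d (towerP L m (j + 1))), ‖(UlevOf L m (n + 1) V j b : 𝔸) - 1‖ ≤ εU j) →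
      ∀ (δUV : ℕ → ℝ), (∀ j, 0 ≤ δUV j) →
        (∀ (j : ℕ) (b : Bond d (towerP L m (j + 1))), ‖(UlevOf L m (n + 1) U j b : 𝔸) - (UlevOf L m (n + 1) V j b : 𝔸)‖ ≤ δUV j) →
      ∀ {α δ : ℝ}, 0 ≤ α → α ≤ α₀ → 0 ≤ δ → δ ≤ δ₀ →
        (∀ b, star (U b : 𝔸) = (((U b)⁻¹ : 𝔸ˣ) : 𝔸)) → (∀ b, star (V b : 𝔸) = (((V b)⁻¹ : 𝔸ˣ) : 𝔸)) →
        (∀ b, U b ∈ U1 𝔸) → (∀ b, V b ∈ U1 𝔸) → (∀ b, ‖(U b : 𝔸) - 1‖ ≤ α * η) → (∀ b, ‖(V b : 𝔸) - 1‖ ≤ α * η) →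
        (∀ p : B9SectCLatticeCarrier.Plaq d (towerP L m (n + 1)), ‖(plaqHolU U p : 𝔸) - 1‖ ≤ α * η ^ 2) →
        (∀ p : B9SectCLatticeCarrier.Plaq d (towerP L m (n + 1)), ‖(plaqHolU V p : 𝔸) - 1‖ ≤ α * η ^ 2) →
        (∀ b, ‖(U b : 𝔸) - (V b : 𝔸)‖ ≤ δ * η) →
        (∀ p : B9SectCLatticeCarrier.Plaq d (towerP L m (n + 1)), ‖(plaqHolU U p : 𝔸) - (plaqHolU V p : 𝔸)‖ ≤ δ * η ^ 2) →
        (∀ j < n + 1, εU j ≤ α * r ^ j) → (∀ j, δUV j ≤ δ * r ^ j) →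
        ∀ (hposU : ∀ x : BondL2K ℂ d (towerP L m (n + 1)) c₀ W, x ≠ 0 →
            0 < RCLike.re ⟪x, laplaceAk L m n φ η U hL αU hα1 hU1 hreg τ (c₀ := c₀) (c₁ := c₁) a₀ x⟫_ℂ)
          (hposV : ∀ x : BondL2K ℂ d (towerP L m (n + 1)) c₀ W, x ≠ 0 →
            0 < RCLike.re ⟪x, laplaceAk L m n φ η V hL αV hα1' hV1 hregV τ (c₀ := c₀) (c₁ := c₁) a₀ x⟫_ℂ)
          (hQU : Function.Surjective (QkW L m n φ U hL αU hα1 hU1 hreg (c₀ := c₀) (c₁ := c₁)))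
          (hQV : Function.Surjective (QkW L m n φ V hL αV hα1' hV1 hregV (c₀ := c₀) (c₁ := c₁)))
          {W₁ : Space115 (L : ℝ) η lev₀ lev₁ (nabla115 η U) → NegSize (L : ℝ) η lev₀ 3 𝔸}
          {W₂ : Space115 (L : ℝ) η lev₀ lev₁ (nabla115 η V) → NegSize (L : ℝ) η lev₀ 3 𝔸}
          {B₀ θ C₄ a₃ j a ε₄ B₀' θ' C₄' a₃' j' a' ε₄' δW ρ s : ℝ}
          (_R₁ : Regime (frakGLatticeCLM (L := (L : ℝ)) (η := η) (lev₀ := lev₀) φ hposU hQU lev₁ (nabla115 η U)) 0 W₁ B₀ θ C₄ a₃ j a ε₄)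
          (_R₂ : Regime (frakGLatticeCLM (L := (L : ℝ)) (η := η) (lev₀ := lev₀) φ hposV hQV lev₁ (nabla115 η V)) 0 W₂ B₀' θ' C₄' a₃' j' a' ε₄')
          (_hj : 0 ≤ j) (_hj' : 0 ≤ j') (B : NegSize (L : ℝ) η levB 0 𝔸)
          (_hB : ‖H1LatticeCLM (L := (L : ℝ)) (η := η) (lev₀ := lev₀) (levB := levB) φ hposU hQU lev₁ (nabla115 η U) B‖ < a)
          (_hB' : ‖H1LatticeCLM (L := (L : ℝ)) (η := η) (lev₀ := lev₀) (levB := levB) φ hposV hQV lev₁ (nabla115 η V) B‖ < a')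
          (_hδW : ∀ P : Space115 (L : ℝ) η lev₀ lev₁ (nabla115 η U), ‖P‖ < ε₄ + a →
            ‖W₁ P - W₂ (LinearMap.toContinuousLinearMap
              ((jetLinearEquiv (L : ℝ) η lev₀ lev₁ (nabla115 η V)).symm.toLinearMap ∘ₗ
                (jetLinearEquiv (L : ℝ) η lev₀ lev₁ (nabla115 η U)).toLinearMap) P)‖ ≤ δW)
          (_hρ₁ : (1 + (NegSup.wSup (levWeight (L : ℝ) η lev₁ 2) : ℝ) * (2 * ‖((η : ℂ))⁻¹‖ * (δ * η)) * NegSup.wInvSup (levWeight (L : ℝ) η lev₀ 1)) *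
            (ε₄ + a) ≤ ρ)
          (_hρ₂ : ε₄' + a' ≤ ρ) (_hs : 0 < s) (_hdom : 2 * (ρ + s) ≤ a₃') (_hκ : θ' + 4 * B₀' * C₄' * (ρ + s) < 1),
        ‖LinearMap.toContinuousLinearMap
              ((jetLinearEquiv (L : ℝ) η lev₀ lev₁ (nabla115 η V)).symm.toLinearMap ∘ₗ
                (jetLinearEquiv (L : ℝ) η lev₀ lev₁ (nabla115 η U)).toLinearMap)
            (solA (frakGLatticeCLM (L := (L : ℝ)) (η := η) (lev₀ := lev₀) φ hposU hQU lev₁ (nabla115 η U)) 0 W₁ 0 ε₄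
                (H1LatticeCLM (L := (L : ℝ)) (η := η) (lev₀ := lev₀) (levB := levB) φ hposU hQU lev₁ (nabla115 η U) B) +
              H1LatticeCLM (L := (L : ℝ)) (η := η) (lev₀ := lev₀) (levB := levB) φ hposU hQU lev₁ (nabla115 η U) B) -
          (solA (frakGLatticeCLM (L := (L : ℝ)) (η := η) (lev₀ := lev₀) φ hposV hQV lev₁ (nabla115 η V)) 0 W₂ 0 ε₄'
              (H1LatticeCLM (L := (L : ℝ)) (η := η) (lev₀ := lev₀) (levB := levB) φ hposV hQV lev₁ (nabla115 η V) B) +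
            H1LatticeCLM (L := (L : ℝ)) (η := η) (lev₀ := lev₀) (levB := levB) φ hposV hQV lev₁ (nabla115 η V) B)‖ ≤
          (K * (max (NegSup.wSup (levWeight (L : ℝ) η lev₀ 1) : ℝ) (NegSup.wSup (levWeight (L : ℝ) η lev₁ 2) * (2 * ‖((η : ℂ))⁻¹‖)) *
                (Mφ * Real.sqrt (c₀ * Fintype.card (Bond d (towerP L m (n + 1)))) * Mφ' / Real.sqrt c₀) *
                NegSup.wInvSup (levWeight (L : ℝ) η lev₀ 3)) * δ * (j + C₄ * (ε₄ + a) ^ 2) + B₀' * δW +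
            K * (max (NegSup.wSup (levWeight (L : ℝ) η lev₀ 1) : ℝ) (NegSup.wSup (levWeight (L : ℝ) η lev₁ 2) * (2 * ‖((η : ℂ))⁻¹‖)) *
                (Mφ * Real.sqrt (c₁ * Fintype.card (Bond d m)) * Mφ' / Real.sqrt c₀) *
                NegSup.wInvSup (levWeight (L : ℝ) η levB 0)) * δ * ‖B‖) / (1 - (θ' + 4 * B₀' * C₄' * (ρ + s))) := by
  obtain ⟨α₀, δ₀, K, hα₀, hδ₀, hK, H⟩ :=
    exists_letter_defects_tower_two_backgrounds_closed hd L hL φ hMφ hMφ' hφ hφ' ha₀ hr0 hr1 τ hτ hCτ hρw hτ₁ hτ₂ hφτ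
  refine ⟨α₀, δ₀, K, hα₀, hδ₀, hK, ?_⟩
  intro n η _ hηL hL3 c₀ c₁ _ _ hw hρ m _ lev₀ levB lev₁ U V αU hα1 hU1 hreg αV hα1' hV1 hregV hα128 εU hεU hUε hVε δUV hδUV hLUV α δ hα0 hαle hδ0 hδle
    hUst hVst hUb hVb hUη hVη hplU hplV hUV hpp hεg hδg hposU hposV hQU hQV W₁ W₂ B₀ θ C₄ a₃ j a ε₄ B₀' θ' C₄' a₃' j' a' ε₄' δW ρ s R₁ R₂ hj hj' B hB hB'
    hδW hρ₁ hρ₂ hs hdom hκ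
  obtain ⟨hι, HG, HA⟩ := H n η hηL hL3 c₀ c₁ hw hρ m lev₀ levB lev₁ U V αU hα1 hU1 hreg αV hα1' hV1 hregV hα128 εU hεU hUε hVε δUV hδUV hLUV hα0 hαle
    hδ0 hδle hUst hVst hUb hVb hUη hVη hplU hplV hUV hpp hεg hδg hposU hposV hQU hQV
  have hJ : ‖(0 : NegSize (L : ℝ) η lev₀ 3 𝔸)‖ ≤ j := by rw [norm_zero]; exact hj
  have hJ' : ‖(0 : NegSize (L : ℝ) η lev₀ 3 𝔸)‖ ≤ j' := by rw [norm_zero]; exact hj'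
  have hδη : 0 ≤ δ * η := mul_nonneg hδ0 (le_of_lt (Fact.out : 0 < η))
  have hδΛ : ∀ y : Space115 (L : ℝ) η lev₀ lev₁ (nabla115 η U),
      ‖LinearMap.toContinuousLinearMap
          ((jetLinearEquiv (L : ℝ) η lev₀ lev₁ (nabla115 η V)).symm.toLinearMap ∘ₗ
            (jetLinearEquiv (L : ℝ) η lev₀ lev₁ (nabla115 η U)).toLinearMap) ((0 : _ →L[ℂ] _) y) -
        (0 : _ →L[ℂ] _) (LinearMap.toContinuousLinearMap
          ((jetLinearEquiv (L : ℝ) η lev₀ lev₁ (nabla115 η V)).symm.toLinearMap ∘ₗ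
            (jetLinearEquiv (L : ℝ) η lev₀ lev₁ (nabla115 η U)).toLinearMap) y)‖ ≤ 0 * ‖y‖ := fun y => by simp
  have hKG : 0 ≤ K * (max (NegSup.wSup (levWeight (L : ℝ) η lev₀ 1) : ℝ) (NegSup.wSup (levWeight (L : ℝ) η lev₁ 2) * (2 * ‖((η : ℂ))⁻¹‖)) *
      (Mφ * Real.sqrt (c₀ * Fintype.card (Bond d (towerP L m (n + 1)))) * Mφ' / Real.sqrt c₀) * NegSup.wInvSup (levWeight (L : ℝ) η lev₀ 3)) * δ := by
    have : 0 ≤ (max (NegSup.wSup (levWeight (L : ℝ) η lev₀ 1) : ℝ) (NegSup.wSup (levWeight (L : ℝ) η lev₁ 2) * (2 * ‖((η : ℂ))⁻¹‖))) :=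
      le_max_of_le_left (NegSup.wSup (levWeight (L : ℝ) η lev₀ 1)).coe_nonneg
    positivity
  have hG' : ∀ f : NegSize (L : ℝ) η lev₀ 3 𝔸,
      ‖LinearMap.toContinuousLinearMap
          ((jetLinearEquiv (L : ℝ) η lev₀ lev₁ (nabla115 η V)).symm.toLinearMap ∘ₗ
            (jetLinearEquiv (L : ℝ) η lev₀ lev₁ (nabla115 η U)).toLinearMap)
          (frakGLatticeCLM (L := (L : ℝ)) (η := η) (lev₀ := lev₀) φ hposU hQU lev₁ (nabla115 η U) f) -
        frakGLatticeCLM (L := (L : ℝ)) (η := η) (lev₀ := lev₀) φ hposV hQV lev₁ (nabla115 η V) f‖ ≤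
      (K * (max (NegSup.wSup (levWeight (L : ℝ) η lev₀ 1) : ℝ) (NegSup.wSup (levWeight (L : ℝ) η lev₁ 2) * (2 * ‖((η : ℂ))⁻¹‖)) *
        (Mφ * Real.sqrt (c₀ * Fintype.card (Bond d (towerP L m (n + 1)))) * Mφ' / Real.sqrt c₀) * NegSup.wInvSup (levWeight (L : ℝ) η lev₀ 3)) * δ) * ‖f‖ :=
    fun f => (HG f).trans_eq (by ring)
  have h := norm_map_arg_sub_arg_le (J := (0 : NegSize (L : ℝ) η lev₀ 3 𝔸)) R₁ R₂ hJ hJ' hB hB' (by positivity) hι hKG le_rfl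
    hG' hδΛ hδW (HA B) hρ₁ hρ₂ hs hdom hκ
  refine h.trans (le_of_eq ?_)
  congr 1
  ring

set_option maxHeartbeats 800000 in
set_option maxRecDepth 8192 in
/-- **THE FULL CHART (174)∘(47) OF `cur U` AT THE `k`-TH-STEP LETTERS IS LIPSCHITZ IN THE BACKGROUND BETWEEN TWO SMALL BACKGROUNDS (diagonal)** — the
species' `chartHB 𝔊_k(X) 0 W 0 (A′ ↦ A′ + solA H_k(X) 0 C_k(X) 0 ε_C A′) ε₄ H_k(X)` at `X = U` read into the (115) norm at `∇_V` against `X = V`: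
`‖ι(chartHB_U B) − chartHB_V B‖ ≤ (K·V_G·δ·(j + C₄(ε₄+a)²) + B₀′δ_W + K·V_H·δ·‖B‖)∕((1 − κ₂)(1 − κ_C)) + (K·V_H·δ·C₂(ε_C + a_C)² + b′δ_C)∕(1 − κ_C)`, the
letter defects PRODUCED by INTENT-2, the (L3) slot's modulus `δ_W`, the `C_k`-letter's modulus `δ_C` (`B11Eq44CLetterTower.Cck` at `U` against `V`) and
the four regimes' scalar letters DISPLAYED; composition by the owner's `norm_map_chartHB_sectC_sub_le`. [folklore]
[cite: Balaban1985Variational, (174)–(175) p.305, (44) p.285, (47)–(50) p.285, Prop. 6 (116)–(121) p.295, (117) p.295, Prop. 9 p.309; Balaban1985BackgroundPropagators, Thm 3.4 p.400] -/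
theorem exists_chartHB_lipschitz_tower_two_backgrounds [Fact (0 < (L : ℝ))] :
    ∃ α₀ δ₀ K : ℝ, 0 < α₀ ∧ 0 < δ₀ ∧ 0 < K ∧ ∀ (n : ℕ) (η : ℝ) [Fact (0 < η)], η * (L : ℝ) ^ (n + 1) = 1 → 3 ≤ L ^ (n + 1) →
      ∀ (c₀ c₁ : ℝ) [Fact (0 < c₀)] [Fact (0 < c₁)], c₀ * ((L : ℝ) ^ (n + 1)) ^ d = c₁ → |η| ^ d / c₀ ≤ ρw →
      ∀ (m : Fin d → ℕ) [∀ i, NeZero (m i)] (lev₀ : Bond d (towerP L m (n + 1)) → ℕ) (levB : Bond d m → ℕ)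
        (lev₁ : Bond d (towerP L m (n + 1)) × Fin d → ℕ)
        (U V : Bond d (towerP L m (n + 1)) → 𝔸ˣ) (αU : ℕ → ℝ) (hα1 : ∀ j, αU j ≤ 1 / 64)
        (hU1 : ∀ (j : ℕ) (x : B7Prop1Explicit.Site d) (κ : Fin d), perCfg (towerP L m (j + 1)) (UlevOf L m (n + 1) U j) x κ ∈ U1 𝔸)
        (hreg : ∀ (j : ℕ) (y : TSite d (towerP L m j)) (κ : Fin d) (r : Fin d → Fin L),
          ‖((Wcx L (perCfg (towerP L m (j + 1)) (UlevOf L m (n + 1) U j)) (cornerSite L y) κ (boxVec L r) : 𝔸ˣ) : 𝔸) - 1‖ ≤ αU j)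
        (αV : ℕ → ℝ) (hα1' : ∀ j, αV j ≤ 1 / 64)
        (hV1 : ∀ (j : ℕ) (x : B7Prop1Explicit.Site d) (κ : Fin d), perCfg (towerP L m (j + 1)) (UlevOf L m (n + 1) V j) x κ ∈ U1 𝔸)
        (hregV : ∀ (j : ℕ) (y : TSite d (towerP L m j)) (κ : Fin d) (r : Fin d → Fin L),
          ‖((Wcx L (perCfg (towerP L m (j + 1)) (UlevOf L m (n + 1) V j)) (cornerSite L y) κ (boxVec L r) : 𝔸ˣ) : 𝔸) - 1‖ ≤ αV j),
        (∀ j, αV j ≤ 1 / 128) →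
      ∀ (εU : ℕ → ℝ), (∀ j, 0 ≤ εU j) → (∀ (j : ℕ) (b : Bond d (towerP L m (j + 1))), ‖(UlevOf L m (n + 1) U j b : 𝔸) - 1‖ ≤ εU j) →
        (∀ (j : ℕ) (b : Bond d (towerP L m (j + 1))), ‖(UlevOf L m (n + 1) V j b : 𝔸) - 1‖ ≤ εU j) →
      ∀ (δUV : ℕ → ℝ), (∀ j, 0 ≤ δUV j) →
        (∀ (j : ℕ) (b : Bond d (towerP L m (j + 1))), ‖(UlevOf L m (n + 1) U j b : 𝔸) - (UlevOf L m (n + 1) V j b : 𝔸)‖ ≤ δUV j) →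
      ∀ {α δ : ℝ}, 0 ≤ α → α ≤ α₀ → 0 ≤ δ → δ ≤ δ₀ →
        (∀ b, star (U b : 𝔸) = (((U b)⁻¹ : 𝔸ˣ) : 𝔸)) → (∀ b, star (V b : 𝔸) = (((V b)⁻¹ : 𝔸ˣ) : 𝔸)) →
        (∀ b, U b ∈ U1 𝔸) → (∀ b, V b ∈ U1 𝔸) → (∀ b, ‖(U b : 𝔸) - 1‖ ≤ α * η) → (∀ b, ‖(V b : 𝔸) - 1‖ ≤ α * η) →
        (∀ p : B9SectCLatticeCarrier.Plaq d (towerP L m (n + 1)), ‖(plaqHolU U p : 𝔸) - 1‖ ≤ α * η ^ 2) →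
        (∀ p : B9SectCLatticeCarrier.Plaq d (towerP L m (n + 1)), ‖(plaqHolU V p : 𝔸) - 1‖ ≤ α * η ^ 2) →
        (∀ b, ‖(U b : 𝔸) - (V b : 𝔸)‖ ≤ δ * η) →
        (∀ p : B9SectCLatticeCarrier.Plaq d (towerP L m (n + 1)), ‖(plaqHolU U p : 𝔸) - (plaqHolU V p : 𝔸)‖ ≤ δ * η ^ 2) →
        (∀ j < n + 1, εU j ≤ α * r ^ j) → (∀ j, δUV j ≤ δ * r ^ j) →
        ∀ (hposU : ∀ x : BondL2K ℂ d (towerP L m (n + 1)) c₀ W, x ≠ 0 →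
            0 < RCLike.re ⟪x, laplaceAk L m n φ η U hL αU hα1 hU1 hreg τ (c₀ := c₀) (c₁ := c₁) a₀ x⟫_ℂ)
          (hposV : ∀ x : BondL2K ℂ d (towerP L m (n + 1)) c₀ W, x ≠ 0 →
            0 < RCLike.re ⟪x, laplaceAk L m n φ η V hL αV hα1' hV1 hregV τ (c₀ := c₀) (c₁ := c₁) a₀ x⟫_ℂ)
          (hQU : Function.Surjective (QkW L m n φ U hL αU hα1 hU1 hreg (c₀ := c₀) (c₁ := c₁)))
          (hQV : Function.Surjective (QkW L m n φ V hL αV hα1' hV1 hregV (c₀ := c₀) (c₁ := c₁)))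
          {W₁ : Space115 (L : ℝ) η lev₀ lev₁ (nabla115 η U) → NegSize (L : ℝ) η lev₀ 3 𝔸}
          {W₂ : Space115 (L : ℝ) η lev₀ lev₁ (nabla115 η V) → NegSize (L : ℝ) η lev₀ 3 𝔸}
          {B₀ θ C₄ a₃ j a ε₄ B₀' θ' C₄' a₃' j' a' ε₄' δW ρ s : ℝ}
          (_R₁ : Regime (frakGLatticeCLM (L := (L : ℝ)) (η := η) (lev₀ := lev₀) φ hposU hQU lev₁ (nabla115 η U)) 0 W₁ B₀ θ C₄ a₃ j a ε₄)
          (_R₂ : Regime (frakGLatticeCLM (L := (L : ℝ)) (η := η) (lev₀ := lev₀) φ hposV hQV lev₁ (nabla115 η V)) 0 W₂ B₀' θ' C₄' a₃' j' a' ε₄')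
          (_hj : 0 ≤ j) (_hj' : 0 ≤ j') (B : NegSize (L : ℝ) η levB 0 𝔸)
          (_hB : ‖H1LatticeCLM (L := (L : ℝ)) (η := η) (lev₀ := lev₀) (levB := levB) φ hposU hQU lev₁ (nabla115 η U) B‖ < a)
          (_hB' : ‖H1LatticeCLM (L := (L : ℝ)) (η := η) (lev₀ := lev₀) (levB := levB) φ hposV hQV lev₁ (nabla115 η V) B‖ < a')
          (_hδW : ∀ P : Space115 (L : ℝ) η lev₀ lev₁ (nabla115 η U), ‖P‖ < ε₄ + a →
            ‖W₁ P - W₂ (LinearMap.toContinuousLinearMap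
              ((jetLinearEquiv (L : ℝ) η lev₀ lev₁ (nabla115 η V)).symm.toLinearMap ∘ₗ
                (jetLinearEquiv (L : ℝ) η lev₀ lev₁ (nabla115 η U)).toLinearMap) P)‖ ≤ δW)
          (_hρ₁ : (1 + (NegSup.wSup (levWeight (L : ℝ) η lev₁ 2) : ℝ) * (2 * ‖((η : ℂ))⁻¹‖ * (δ * η)) * NegSup.wInvSup (levWeight (L : ℝ) η lev₀ 1)) *
            (ε₄ + a) ≤ ρ)
          (_hρ₂ : ε₄' + a' ≤ ρ) (_hs : 0 < s) (_hdom : 2 * (ρ + s) ≤ a₃') (_hκ : θ' + 4 * B₀' * C₄' * (ρ + s) < 1)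
          {b C₂c c₄ aC εC b' C₂c' c₄' aC' εC' δC ρC sC : ℝ}
          (_RC₁ : Regime (H1LatticeCLM (L := (L : ℝ)) (η := η) (lev₀ := lev₀) (levB := levB) φ hposU hQU lev₁ (nabla115 η U)) 0
            (Cck L m η (n + 1) U lev₀ lev₁ (nabla115 η U) levB) b 0 C₂c c₄ 0 aC εC)
          (_RC₂ : Regime (H1LatticeCLM (L := (L : ℝ)) (η := η) (lev₀ := lev₀) (levB := levB) φ hposV hQV lev₁ (nabla115 η V)) 0
            (Cck L m η (n + 1) V lev₀ lev₁ (nabla115 η V) levB) b' 0 C₂c' c₄' 0 aC' εC')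
          (_hcap : ε₄ + a ≤ aC) (_hcap' : ε₄' + a' ≤ aC')
          (_hδC : ∀ P : Space115 (L : ℝ) η lev₀ lev₁ (nabla115 η U), ‖P‖ < εC + aC →
            ‖Cck L m η (n + 1) U lev₀ lev₁ (nabla115 η U) levB P - Cck L m η (n + 1) V lev₀ lev₁ (nabla115 η V) levB
              (LinearMap.toContinuousLinearMap
                ((jetLinearEquiv (L : ℝ) η lev₀ lev₁ (nabla115 η V)).symm.toLinearMap ∘ₗ
                  (jetLinearEquiv (L : ℝ) η lev₀ lev₁ (nabla115 η U)).toLinearMap) P)‖ ≤ δC)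
          (_hρC₁ : (1 + (NegSup.wSup (levWeight (L : ℝ) η lev₁ 2) : ℝ) * (2 * ‖((η : ℂ))⁻¹‖ * (δ * η)) * NegSup.wInvSup (levWeight (L : ℝ) η lev₀ 1)) *
            (εC + aC) ≤ ρC)
          (_hρC₂ : εC' + aC' ≤ ρC) (_hsC : 0 < sC) (_hdomC : 2 * (ρC + sC) ≤ c₄') (_hκC : 4 * b' * C₂c' * (ρC + sC) < 1),
        ‖LinearMap.toContinuousLinearMap
              ((jetLinearEquiv (L : ℝ) η lev₀ lev₁ (nabla115 η V)).symm.toLinearMap ∘ₗ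
                (jetLinearEquiv (L : ℝ) η lev₀ lev₁ (nabla115 η U)).toLinearMap)
            (chartHB (frakGLatticeCLM (L := (L : ℝ)) (η := η) (lev₀ := lev₀) φ hposU hQU lev₁ (nabla115 η U)) 0 W₁ 0
              (fun A' => A' + solA (H1LatticeCLM (L := (L : ℝ)) (η := η) (lev₀ := lev₀) (levB := levB) φ hposU hQU lev₁ (nabla115 η U)) 0
                (Cck L m η (n + 1) U lev₀ lev₁ (nabla115 η U) levB) 0 εC A') ε₄
              (H1LatticeCLM (L := (L : ℝ)) (η := η) (lev₀ := lev₀) (levB := levB) φ hposU hQU lev₁ (nabla115 η U)) B) -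
          chartHB (frakGLatticeCLM (L := (L : ℝ)) (η := η) (lev₀ := lev₀) φ hposV hQV lev₁ (nabla115 η V)) 0 W₂ 0
            (fun A' => A' + solA (H1LatticeCLM (L := (L : ℝ)) (η := η) (lev₀ := lev₀) (levB := levB) φ hposV hQV lev₁ (nabla115 η V)) 0
              (Cck L m η (n + 1) V lev₀ lev₁ (nabla115 η V) levB) 0 εC' A') ε₄'
            (H1LatticeCLM (L := (L : ℝ)) (η := η) (lev₀ := lev₀) (levB := levB) φ hposV hQV lev₁ (nabla115 η V)) B‖ ≤
          1 / (1 - 4 * b' * C₂c' * (ρC + sC)) *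
              ((K * (max (NegSup.wSup (levWeight (L : ℝ) η lev₀ 1) : ℝ) (NegSup.wSup (levWeight (L : ℝ) η lev₁ 2) * (2 * ‖((η : ℂ))⁻¹‖)) *
                    (Mφ * Real.sqrt (c₀ * Fintype.card (Bond d (towerP L m (n + 1)))) * Mφ' / Real.sqrt c₀) *
                    NegSup.wInvSup (levWeight (L : ℝ) η lev₀ 3)) * δ * (j + C₄ * (ε₄ + a) ^ 2) + 0 * (ε₄ + a) + B₀' * δW +
                K * (max (NegSup.wSup (levWeight (L : ℝ) η lev₀ 1) : ℝ) (NegSup.wSup (levWeight (L : ℝ) η lev₁ 2) * (2 * ‖((η : ℂ))⁻¹‖)) *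
                    (Mφ * Real.sqrt (c₁ * Fintype.card (Bond d m)) * Mφ' / Real.sqrt c₀) *
                    NegSup.wInvSup (levWeight (L : ℝ) η levB 0)) * δ * ‖B‖) / (1 - (θ' + 4 * B₀' * C₄' * (ρ + s)))) +
            (K * (max (NegSup.wSup (levWeight (L : ℝ) η lev₀ 1) : ℝ) (NegSup.wSup (levWeight (L : ℝ) η lev₁ 2) * (2 * ‖((η : ℂ))⁻¹‖)) *
                  (Mφ * Real.sqrt (c₁ * Fintype.card (Bond d m)) * Mφ' / Real.sqrt c₀) *
                  NegSup.wInvSup (levWeight (L : ℝ) η levB 0)) * δ * (C₂c * (εC + aC) ^ 2) + b' * δC) / (1 - 4 * b' * C₂c' * (ρC + sC)) := by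
  obtain ⟨α₀, δ₀, K, hα₀, hδ₀, hK, H⟩ :=
    exists_letter_defects_tower_two_backgrounds_closed hd L hL φ hMφ hMφ' hφ hφ' ha₀ hr0 hr1 τ hτ hCτ hρw hτ₁ hτ₂ hφτ
  refine ⟨α₀, δ₀, K, hα₀, hδ₀, hK, ?_⟩
  intro n η _ hηL hL3 c₀ c₁ _ _ hw hρ m _ lev₀ levB lev₁ U V αU hα1 hU1 hreg αV hα1' hV1 hregV hα128 εU hεU hUε hVε δUV hδUV hLUV α δ hα0 hαle hδ0 hδle
    hUst hVst hUb hVb hUη hVη hplU hplV hUV hpp hεg hδg hposU hposV hQU hQV W₁ W₂ B₀ θ C₄ a₃ j a ε₄ B₀' θ' C₄' a₃' j' a' ε₄' δW ρ s R₁ R₂ hj hj' B hB hB'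
    hδW hρ₁ hρ₂ hs hdom hκ b C₂c c₄ aC εC b' C₂c' c₄' aC' εC' δC ρC sC RC₁ RC₂ hcap hcap' hδC hρC₁ hρC₂ hsC hdomC hκC
  obtain ⟨hι, HG, HA⟩ := H n η hηL hL3 c₀ c₁ hw hρ m lev₀ levB lev₁ U V αU hα1 hU1 hreg αV hα1' hV1 hregV hα128 εU hεU hUε hVε δUV hδUV hLUV hα0 hαle
    hδ0 hδle hUst hVst hUb hVb hUη hVη hplU hplV hUV hpp hεg hδg hposU hposV hQU hQV
  have hδη : 0 ≤ δ * η := mul_nonneg hδ0 (le_of_lt (Fact.out : 0 < η))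
  have hmax : 0 ≤ (max (NegSup.wSup (levWeight (L : ℝ) η lev₀ 1) : ℝ) (NegSup.wSup (levWeight (L : ℝ) η lev₁ 2) * (2 * ‖((η : ℂ))⁻¹‖))) :=
    le_max_of_le_left (NegSup.wSup (levWeight (L : ℝ) η lev₀ 1)).coe_nonneg
  have hKG : 0 ≤ K * (max (NegSup.wSup (levWeight (L : ℝ) η lev₀ 1) : ℝ) (NegSup.wSup (levWeight (L : ℝ) η lev₁ 2) * (2 * ‖((η : ℂ))⁻¹‖)) *
      (Mφ * Real.sqrt (c₀ * Fintype.card (Bond d (towerP L m (n + 1)))) * Mφ' / Real.sqrt c₀) * NegSup.wInvSup (levWeight (L : ℝ) η lev₀ 3)) * δ := by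
    positivity
  have hKA : 0 ≤ K * (max (NegSup.wSup (levWeight (L : ℝ) η lev₀ 1) : ℝ) (NegSup.wSup (levWeight (L : ℝ) η lev₁ 2) * (2 * ‖((η : ℂ))⁻¹‖)) *
      (Mφ * Real.sqrt (c₁ * Fintype.card (Bond d m)) * Mφ' / Real.sqrt c₀) * NegSup.wInvSup (levWeight (L : ℝ) η levB 0)) * δ := by
    positivity
  have hG' : ∀ f : NegSize (L : ℝ) η lev₀ 3 𝔸,
      ‖LinearMap.toContinuousLinearMap
          ((jetLinearEquiv (L : ℝ) η lev₀ lev₁ (nabla115 η V)).symm.toLinearMap ∘ₗ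
            (jetLinearEquiv (L : ℝ) η lev₀ lev₁ (nabla115 η U)).toLinearMap)
          (frakGLatticeCLM (L := (L : ℝ)) (η := η) (lev₀ := lev₀) φ hposU hQU lev₁ (nabla115 η U) f) -
        frakGLatticeCLM (L := (L : ℝ)) (η := η) (lev₀ := lev₀) φ hposV hQV lev₁ (nabla115 η V) f‖ ≤
      (K * (max (NegSup.wSup (levWeight (L : ℝ) η lev₀ 1) : ℝ) (NegSup.wSup (levWeight (L : ℝ) η lev₁ 2) * (2 * ‖((η : ℂ))⁻¹‖)) *
        (Mφ * Real.sqrt (c₀ * Fintype.card (Bond d (towerP L m (n + 1)))) * Mφ' / Real.sqrt c₀) * NegSup.wInvSup (levWeight (L : ℝ) η lev₀ 3)) * δ) * ‖f‖ :=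
    fun f => (HG f).trans_eq (by ring)
  have hA' : ∀ B : NegSize (L : ℝ) η levB 0 𝔸,
      ‖LinearMap.toContinuousLinearMap
          ((jetLinearEquiv (L : ℝ) η lev₀ lev₁ (nabla115 η V)).symm.toLinearMap ∘ₗ
            (jetLinearEquiv (L : ℝ) η lev₀ lev₁ (nabla115 η U)).toLinearMap)
          (H1LatticeCLM (L := (L : ℝ)) (η := η) (lev₀ := lev₀) (levB := levB) φ hposU hQU lev₁ (nabla115 η U) B) -
        H1LatticeCLM (L := (L : ℝ)) (η := η) (lev₀ := lev₀) (levB := levB) φ hposV hQV lev₁ (nabla115 η V) B‖ ≤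
      (K * (max (NegSup.wSup (levWeight (L : ℝ) η lev₀ 1) : ℝ) (NegSup.wSup (levWeight (L : ℝ) η lev₁ 2) * (2 * ‖((η : ℂ))⁻¹‖)) *
        (Mφ * Real.sqrt (c₁ * Fintype.card (Bond d m)) * Mφ' / Real.sqrt c₀) * NegSup.wInvSup (levWeight (L : ℝ) η levB 0)) * δ) * ‖B‖ :=
    fun B => (HA B).trans_eq (by ring)
  exact norm_map_chartHB_sectC_sub_le R₁ R₂ RC₁ RC₂ hj hj' hB hB' hcap hcap' (by positivity) hι hKG hG' hδW hKA hA' hδC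
    hρ₁ hρ₂ hs hdom hκ hρC₁ hρC₂ hsC hdomC hκC

end Literature.MathematicalPhysics.QuantumFieldTheory.Balaban1983to89.B11Eq174ChartContinuityTowerTwoBackgrounds

end
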